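import Summits.QuantumFields.BalabanUV.Beta.GAN24.LinSandwichShape
import Summits.QuantumFields.BalabanUV.Beta.GAN24.Push4Iter
import Summits.QuantumFields.BalabanUV.Beta.GAN24.Push4LocalityRecord
import Summits.QuantumFields.BalabanUV.Beta.GAN24.RespStepSemigroup
import Summits.QuantumFields.BalabanUV.Beta.GAN24.RespStepDecay
import Summits.QuantumFields.BalabanUV.Beta.GAN24.T2RecursionAffine

/-!
# `BalabanUV.Beta.GAN24.TransportMarginal` — binder row G-an2-4 / (CONV-C), W-slot road «W3», **ROW W3-F3a (T-marg)**: THE `k`-FOLD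
# TRANSPORT OF THE NORMALISED `T₂`-RECURSION IS MARGINALLY BOUNDED ON `LocStencil₂`, UNIFORMLY IN `(m, k)`, UNDER THE PIN (`d = 3`)

NOT IN PRINT; OUR PROOF ATTEMPT (G-an2-4 formalisation swarm, leaf prover `b2b-balaban-gan24-formalise-leaf-10`, gen 17 = holder of ROW W3-F3a
«W3-TMARG*», journal l.8086 ∕ owner ACK l.8133 ∕ plan l.8502; gan24-p1-g5's `SKELETON-W3.md` v1.0.2 §8.3∕§8.6, RULINGS-14b–c; name PROVISIONAL).
HONEST FRAMING (cell contract, verbatim): «discharging `BetaPertH` makes Bałaban's UV stability UNCONDITIONAL — a real constructive-QFT result;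
it is NOT the continuum limit and NOT the Clay problem.»  HONEST DEPENDENCY (verbatim): «continuum YM on T⁴ ⇐ BetaPertH ∧ nine spine estimates
(0/9 proved); BetaPertH ⇐ (D1) ∧ (D4) ∧ CAP+tail; G-an2-4 gates asym, D1 and NE2/3/4.»

WHAT.  ROW W3-F3a of the owner's END `WSlotT2OfPieces.t2Shape_of_rows` is `hTmarg : |cE₂| ≤ Lc^{2(d+1)} → ∀ m k X C, 0 ≤ C → LocStencil₂ X C δin
→ LocStencil₂ (P m k X) (CT·C) δT`, `P m k := AffineUnroll.transport (fun j ↦ T2RecursionAffine.lin4 (cE₂·Lc^{2(d+1)}) K̃_j Lc) m k`,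
`K̃_j = unitK (sfStep Lc j) (smStep d Lc j) (KInvStep Lc j) = CombesThomas.KStepUnit Lc j` (an `abbrev`).  THIS FILE proves it at `d = 3` for one-step
maps written LITERALLY as `A j X κ u κ′ u′ = −(c • mmRead Lc (K̃_j ∘ ½(vertex2OfK K̃_j Lc X κuκ′u′ + vertex2OfK K̃_j Lc X κ′u′κu) ∘ K̃_j))` (the body of
`lin4`, `vsym` written out — `hA` is `rfl` for `A := fun j ↦ lin4 c K̃_j Lc` once p210349 commits; leaf-17's `Push4Sym` convention):
**`transport_marginal`** (pin as `|c| ≤ Lc^16`) and **`transport_marginal_pin`** (`c = cE₂·Lc^{2(3+1)}`, pin `|cE₂| ≤ Lc^{2(3+1)}` verbatim; `CT`, `δT`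
chosen BEFORE the pin, `0 < δT ≤ δin`).  Inputs: the K-slot's uniform decay `UnitDecayK 3 Lc (sfStep Lc) (smStep 3 Lc) CK mK`, `Lc ≥ 1`, `δin > 0`.
THE CHAIN (tree names; this file threads them): `k = 0` identity ∙ FIRST STEP on a GENERAL table (R14-7) `LinSandwichShape.locStencil₂_lin_step`,
output ff-valued (`step_shape`, `step_isFF`) ∙ on ff-valued `LocStencil₂` tables `A j = (−c) •` the bond-symmetrised push (leaf-17's
`Push4Sym.mmRead_sandwich_vsym_eq_push₄`; `step_eq_symPush`), an invariant class (`symPush_mem`: `Push4.isFF_push₄`, `Push4LocStencil.locStencil₂_push₄`,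
`Push4Iter.locStencil₂_symB`) on which the push is homogeneous (`symPush_smul` ⇐ `Push4Iter.push₄_lin`), hence `transport A = (−c)^{k−1} • symB (push₄
(legChain rowM…) (legChain colH…) Y)` (`transport_congr_mem`, leaf-01's `AffineUnroll.transport_smul_eq`, leaf-17's `Push4Iter.transport_symPush`) ∙ the
chains are `±respStep (Lc^{m+1}) (Lc^{m+k})` (leaf-12's `RespStepSemigroup` dictionary iterated, §2) with leaf-12's `(m,k)`-uniform envelopes
`RespStepDecay.exists_respStep_decay_and_grad` ∙ the count is (F3-core-a) of record, leaf-03's `Push4LocalityRecord.exists_push₄_locStencil₂_const`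
(`K₄·A⁴·C·(L^{d+1}·((L^{d+2})⁻¹)⁴)`, `L = Lc^{k−1}`), then `locStencil₂_symB`, `locStencil₂_smul'` ∙ THE PIN: `|c|^{k−1}·((Lc^{k−1})^4·(((Lc^{k−1})^5)⁻¹)⁴)
= (|c|·Lc^{−16})^{k−1} ≤ 1` (`geom_le_one`) is the ONLY place a power of `c` is absorbed (R12-3∕R14-5; exactly marginal at `d = 3`, (N-F3a)).
`CT = 1 + |c|·cSand·(1 + K₄·C_resp⁴)`, `δT = κ₁∕72`, `κ₁ = min κ₀ (min mK δin∕256)`.  [folklore] bookkeeping BY NAME; cites no paper, mints no `def`,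
no `def … : Prop`, instantiates no wall binder, 0 sorry.  HONEST: ROW W3-F3a ONLY — counts LANDED by rule (h) when the END's assembler instantiates
`A := lin4 …`; NOTHING of «T2Shape»∕«T2SupRate»∕(hW, hWall) is discharged by this file alone; the pin is an2's (P6); NOT «W-slot closed», NEVER
«G-an2-4 closed», NOT (CONV-C); NOT `BetaPertH`, NOT continuum, NOT Clay.  Unit `b2b-balaban-gan24-formalise-leaf-10` (gen 17), 2026-08-20.
-/

noncomputable section

open Literature.MathematicalPhysics.QuantumFieldTheory
open Literature.MathematicalPhysics.QuantumFieldTheory.Balaban1983to89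
open Literature.MathematicalPhysics.QuantumFieldTheory.Balaban1983to89.Beta
open B12Sec2to5 (l1 l1_nonneg)
open B4ContourShift (supNorm supNorm_nonneg)
open ExpKernelCalculus (MKer Decays BiLoc comp Zl Zl_pos Zl_nonneg)
open OneStepResolventKernel (Fib decays_mono)
open OneStepKernelFamily (colH KInvStep)
open Summit.QuantumFields.BalabanUV.Beta.HessKerDressedUnits (unitK)
open BalabanCompositeJets (LocStencil₂ respStep)
open BalabanStepJetsSucc (mmRead)
open BalabanStepW2 (locStencil₂_smul' biLoc_le_mono)
open SecondOrderResponse (vertex2OfK cBi cBi_nonneg)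
open LatticeForm (quo)
open Summit.QuantumFields.BalabanUV.Beta.GAN24.CombesThomas (KStepUnit UnitDecayK sfStep smStep)
open Summit.QuantumFields.BalabanUV.Beta.GAN24.T2RecursionAffine (lin4)
open Summit.QuantumFields.BalabanUV.Beta.GAN24.Push4 (rowM push₄ IsFF isFF_push₄ isFF_mmRead)
open Summit.QuantumFields.BalabanUV.Beta.GAN24.Push4Bounds (LegDecay LegDecay.nonneg legDecay_colH legDecay_rowM)
open Summit.QuantumFields.BalabanUV.Beta.GAN24.Push4LocStencil (locStencil₂_push₄ cPush cPush_nonneg)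
open Summit.QuantumFields.BalabanUV.Beta.GAN24.Push4Sym (mmRead_sandwich_vsym_eq_push₄ isFF_lin)
open Summit.QuantumFields.BalabanUV.Beta.GAN24.Push4Iter (BiTab LegFam symB legChain symB_apply legChain_zero legChain_succ locStencil₂_symB
  push₄_lin transport_symPush)
open Summit.QuantumFields.BalabanUV.Beta.GAN24.AffineUnroll (transport transport_zero transport_succ transport_succ' transport_mem
  transport_smul_eq)
open Summit.QuantumFields.BalabanUV.Beta.GAN24.RespStepSemigroup (colH_KStepUnit rowM_KStepUnit_eq legComp_respStep_colH
  legComp_respStep_rowM legComp_neg_left)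
open Summit.QuantumFields.BalabanUV.Beta.GAN24.RespStepDecay (exists_respStep_decay_and_grad)
open Summit.QuantumFields.BalabanUV.Beta.GAN24.Push4LocalityRecord (exists_push₄_locStencil₂_const)
open Summit.QuantumFields.BalabanUV.Beta.GAN24.LinSandwichShape (locStencil₂_lin_step cSand_nonneg)
namespace Summit.QuantumFields.BalabanUV.Beta.GAN24.TransportMarginal

variable {d : ℕ}

/-! ## §0 Generic bricks -/
/-- [folklore] Transports of two families that agree on a class preserved by the second one agree on that class (`AffineUnroll.transport_mem`). -/
theorem transport_congr_mem {E : Type*} {A B : ℕ → E → E} {P : E → Prop} (hBP : ∀ j x, P x → P (B j x))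
    (hAB : ∀ j x, P x → A j x = B j x) (m : ℕ) {x : E} (hx : P x) :
    ∀ k, transport A m k x = transport B m k x
  | 0 => rfl
  | k + 1 => by
    rw [transport_succ, transport_succ, transport_congr_mem hBP hAB m hx k, hAB _ _ (transport_mem hBP m k hx)]

/-- [folklore] `−(c • F)` of an ff-valued kernel is ff-valued. -/
theorem isFF_neg_smul (c : ℝ) {F : MKer (d + 1) (Fib d)} (hF : IsFF F) : IsFF (-(c • F)) :=
  ⟨fun x z μ b => by simp [hF.1 x z μ b], fun x z a ν => by simp [hF.2 x z a ν]⟩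

/-- [folklore] A scalar multiple of an ff-valued kernel is ff-valued. -/
theorem isFF_smul (c : ℝ) {F : MKer (d + 1) (Fib d)} (hF : IsFF F) : IsFF (c • F) :=
  ⟨fun x z μ b => by simp [hF.1 x z μ b], fun x z a ν => by simp [hF.2 x z a ν]⟩

/-- [folklore] The bond symmetrisation of a table with ff-valued entries has ff-valued entries. -/
theorem isFF_symB {Y : BiTab d} (hY : ∀ κ u κ' u', IsFF (Y κ u κ' u')) (μ : Fin (d + 1)) (y : Fin (d + 1) → ℤ) (ν : Fin (d + 1))
    (y' : Fin (d + 1) → ℤ) : IsFF (symB Y μ y ν y') := by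
  rw [symB_apply]
  exact isFF_lin (hY μ y ν y') (hY ν y' μ y) _

/-- [folklore] Weakening a `LocStencil₂` bound: larger constant, smaller rate. -/
theorem locStencil₂_weaken {X : BiTab d} {C C' δ δ' : ℝ} (h : LocStencil₂ X C δ) (hCC : C ≤ C') (hδ : δ' ≤ δ) :
    LocStencil₂ X C' δ' := by
  have hC := h.nonneg
  intro κ u κ' u'
  refine biLoc_le_mono (h κ u κ' u') (by positivity) ?_ hδ
  exact mul_le_mul hCC (Real.exp_le_exp.2 (by nlinarith [l1_nonneg (u' - u)])) (by positivity) (hC.trans hCC)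

/-- [folklore] **THE PIN ARITHMETIC AT `d = 3`**: `|c| ≤ Lc^16 → |c|^n · ((Lc^n)^{3+1} · (((Lc^n)^{3+2})⁻¹)⁴) ≤ 1` (`n` scalars against the
four-leg count `L^{d+1}·(L^{d+2})⁻⁴` at `L = Lc^n`; `|c| ≤ Lc^16` is the pin `|cE₂| ≤ Lc^{2(d+1)}` for `c = cE₂·Lc^{2(d+1)}`). -/
theorem geom_le_one {Lc : ℕ} (hLc : 1 ≤ Lc) {c : ℝ} (hc : |c| ≤ (Lc : ℝ) ^ 16) (n : ℕ) :
    |c| ^ n * (((Lc : ℝ) ^ n) ^ (3 + 1) * (((((Lc : ℝ) ^ n)) ^ (3 + 2))⁻¹) ^ 4) ≤ 1 := by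
  have hL : (1 : ℝ) ≤ (Lc : ℝ) := by exact_mod_cast hLc
  have hq : (0 : ℝ) < (Lc : ℝ) ^ n := by positivity
  have e : ((Lc : ℝ) ^ n) ^ (3 + 1) * (((((Lc : ℝ) ^ n)) ^ (3 + 2))⁻¹) ^ 4 = (((Lc : ℝ) ^ 16) ^ n)⁻¹ := by
    rw [← pow_mul, ← inv_pow, ← pow_mul, inv_pow, ← pow_mul]
    field_simp
    ring
  rw [e, ← div_eq_mul_inv, ← div_pow]
  have h16 : (0 : ℝ) < (Lc : ℝ) ^ 16 := by positivity
  exact pow_le_one₀ (div_nonneg (abs_nonneg c) h16.le) ((div_le_one h16).2 hc)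

/-! ## §1 The one-step map, the invariant class, the symmetrised-push form -/
section Step

variable {Lc : ℕ} [NeZero Lc] {CK mK : ℝ} {c : ℝ} {A : ℕ → BiTab d → BiTab d}

/-- [folklore] **SHAPE OF ONE (GENERAL) STEP** (the first link): under the literal one-step map and the K-slot's uniform decay, ANY table
`LocStencil₂ X C δ` gives `LocStencil₂ (A j X) (|c|·cSand·C) (min mK δ / 128)` (`LinSandwichShape.locStencil₂_lin_step`, `cSand` free of `j`). -/
theorem step_shape (hLc : 1 ≤ Lc) (hK : ∀ j, Decays (KStepUnit (d := d) Lc j) CK mK) (hmK : 0 < mK)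
    (hA : ∀ j X κ u κ' u', A j X κ u κ' u' = -(c • mmRead Lc (comp (comp (KStepUnit (d := d) Lc j)
      ((1 / 2 : ℝ) • (vertex2OfK (KStepUnit (d := d) Lc j) Lc X κ u κ' u' + vertex2OfK (KStepUnit (d := d) Lc j) Lc X κ' u' κ u)))
      (KStepUnit (d := d) Lc j))))
    (j : ℕ) {X : BiTab d} {C δ : ℝ} (hX : LocStencil₂ X C δ) (hδ : 0 < δ) :
    LocStencil₂ (A j X) (|c| * ((Fintype.card (Fib d) : ℝ) * ((Fintype.card (Fib d) : ℝ) * (CK * cBi d CK 1 (min mK δ)) *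
        Zl (d + 1) (min mK δ / 32 / 2) * CK) * Zl (d + 1) (min mK δ / 32 / 4) * C)) (min mK δ / 128) := by
  have hCK : 0 ≤ CK := (hK 0).nonneg (Sum.inl 0)
  have e : A j X = fun κ u κ' u' => -(c • mmRead Lc (comp (comp (KStepUnit (d := d) Lc j)
      ((1 / 2 : ℝ) • (vertex2OfK (KStepUnit (d := d) Lc j) Lc X κ u κ' u' + vertex2OfK (KStepUnit (d := d) Lc j) Lc X κ' u' κ u)))
      (KStepUnit (d := d) Lc j))) := by
    funext κ u κ' u'; exact hA j X κ u κ' u'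
  rw [e]
  exact locStencil₂_lin_step (hK j) hCK hmK hLc c hX hδ

/-- [folklore] **EVERY STEP OUTPUT IS ff-VALUED** (`Push4.isFF_mmRead`). -/
theorem step_isFF
    (hA : ∀ j X κ u κ' u', A j X κ u κ' u' = -(c • mmRead Lc (comp (comp (KStepUnit (d := d) Lc j)
      ((1 / 2 : ℝ) • (vertex2OfK (KStepUnit (d := d) Lc j) Lc X κ u κ' u' + vertex2OfK (KStepUnit (d := d) Lc j) Lc X κ' u' κ u)))
      (KStepUnit (d := d) Lc j))))
    (j : ℕ) (X : BiTab d) (κ : Fin (d + 1)) (u : Fin (d + 1) → ℤ) (κ' : Fin (d + 1)) (u' : Fin (d + 1) → ℤ) :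
    IsFF (A j X κ u κ' u') := by
  rw [hA]
  exact isFF_neg_smul c (isFF_mmRead _ _)

/-- [folklore] **ON ff-VALUED `LocStencil₂` TABLES THE STEP IS `(−c) •` THE BOND-SYMMETRISED PUSH** (leaf-17's `Push4Sym.mmRead_sandwich_vsym_eq_push₄`). -/
theorem step_eq_symPush (hK : ∀ j, Decays (KStepUnit (d := d) Lc j) CK mK) (hmK : 0 < mK)
    (hA : ∀ j X κ u κ' u', A j X κ u κ' u' = -(c • mmRead Lc (comp (comp (KStepUnit (d := d) Lc j)
      ((1 / 2 : ℝ) • (vertex2OfK (KStepUnit (d := d) Lc j) Lc X κ u κ' u' + vertex2OfK (KStepUnit (d := d) Lc j) Lc X κ' u' κ u)))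
      (KStepUnit (d := d) Lc j))))
    (j : ℕ) {Z : BiTab d} (hZff : ∀ κ u κ' u', IsFF (Z κ u κ' u')) {C δ : ℝ} (hZ : LocStencil₂ Z C δ) (hδ : 0 < δ) :
    A j Z = (-c) • symB (push₄ (rowM (KStepUnit (d := d) Lc j) Lc) (colH (KStepUnit (d := d) Lc j) Lc) Z) := by
  funext κ u κ' u'
  rw [hA, mmRead_sandwich_vsym_eq_push₄ (hK j) hmK hZff hZ hδ]
  simp only [Pi.smul_apply, symB_apply, neg_smul]

/-- [folklore] **THE BOND-SYMMETRISED PUSH PRESERVES THE CLASS** «ff-valued ∧ `LocStencil₂` at a positive rate» (`isFF_push₄`, `locStencil₂_push₄`, `locStencil₂_symB`). -/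
theorem symPush_mem (hK : ∀ j, Decays (KStepUnit (d := d) Lc j) CK mK) (hmK : 0 < mK) (j : ℕ) {Z : BiTab d}
    (hZ : (∀ κ u κ' u', IsFF (Z κ u κ' u')) ∧ ∃ C δ : ℝ, 0 < δ ∧ LocStencil₂ Z C δ) :
    (∀ κ u κ' u', IsFF (symB (push₄ (rowM (KStepUnit (d := d) Lc j) Lc) (colH (KStepUnit (d := d) Lc j) Lc) Z) κ u κ' u')) ∧
      ∃ C δ : ℝ, 0 < δ ∧ LocStencil₂ (symB (push₄ (rowM (KStepUnit (d := d) Lc j) Lc) (colH (KStepUnit (d := d) Lc j) Lc) Z)) C δ := by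
  obtain ⟨-, C, δ, hδ, hZl⟩ := hZ
  have hCK : 0 ≤ CK := (hK 0).nonneg (Sum.inl 0)
  have hLpos : (0 : ℝ) < (Lc : ℝ) := by exact_mod_cast Nat.pos_of_ne_zero (NeZero.ne Lc)
  refine ⟨fun κ u κ' u' => isFF_symB (fun μ y ν y' => isFF_push₄ _ _ Z μ y ν y') κ u κ' u', ?_⟩
  obtain ⟨δ', hδ'0, hδ'δ, hδ'm⟩ : ∃ δ' : ℝ, 0 < δ' ∧ δ' ≤ δ ∧ 3 * δ' < mK := by
    refine ⟨min δ (mK / 4), lt_min hδ (by positivity), min_le_left _ _, ?_⟩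
    have := min_le_right δ (mK / 4); linarith
  have hP := locStencil₂_push₄ (legDecay_rowM (N := Lc) (hK j)) (legDecay_colH (N := Lc) (hK j)) (hZl.mono hδ'δ) hδ'0.le hδ'm
  exact ⟨_, _, by positivity, locStencil₂_symB hP (by positivity)⟩

/-- [folklore] **THE BOND-SYMMETRISED PUSH IS HOMOGENEOUS** on `LocStencil₂` tables (`Push4Iter.push₄_lin` with `Y₁ = Y₂`). -/
theorem symPush_smul (hK : ∀ j, Decays (KStepUnit (d := d) Lc j) CK mK) (hmK : 0 < mK) (j : ℕ) (s : ℝ) {Z : BiTab d}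
    {C δ : ℝ} (hZ : LocStencil₂ Z C δ) (hδ : 0 < δ) :
    symB (push₄ (rowM (KStepUnit (d := d) Lc j) Lc) (colH (KStepUnit (d := d) Lc j) Lc) (s • Z)) =
      s • symB (push₄ (rowM (KStepUnit (d := d) Lc j) Lc) (colH (KStepUnit (d := d) Lc j) Lc) Z) := by
  have hl := legDecay_rowM (N := Lc) (hK j)
  have hr := legDecay_colH (N := Lc) (hK j)
  have e : s • Z = (s / 2) • (Z + Z) := by rw [smul_add, ← add_smul, add_halves]
  have hom : ∀ μ y ν y', push₄ (rowM (KStepUnit (d := d) Lc j) Lc) (colH (KStepUnit (d := d) Lc j) Lc) (s • Z) μ y ν y' =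
      s • push₄ (rowM (KStepUnit (d := d) Lc j) Lc) (colH (KStepUnit (d := d) Lc j) Lc) Z μ y ν y' := by
    intro μ y ν y'
    rw [e, push₄_lin hl hr hmK hZ hZ hδ (s / 2) μ y ν y']
    module
  funext μ y ν y'
  rw [symB_apply, hom, hom]
  simp only [Pi.smul_apply, symB_apply]
  module

/-- [folklore] **ON THE CLASS, THE TRANSPORT IS `(−c)^k •` THE TRANSPORT OF THE SYMMETRISED PUSHES** (`transport_congr_mem` + `AffineUnroll.transport_smul_eq`). -/
theorem transport_eq_smul_symPush (hK : ∀ j, Decays (KStepUnit (d := d) Lc j) CK mK) (hmK : 0 < mK)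
    (hA : ∀ j X κ u κ' u', A j X κ u κ' u' = -(c • mmRead Lc (comp (comp (KStepUnit (d := d) Lc j)
      ((1 / 2 : ℝ) • (vertex2OfK (KStepUnit (d := d) Lc j) Lc X κ u κ' u' + vertex2OfK (KStepUnit (d := d) Lc j) Lc X κ' u' κ u)))
      (KStepUnit (d := d) Lc j))))
    (m k : ℕ) {Y : BiTab d} (hY : (∀ κ u κ' u', IsFF (Y κ u κ' u')) ∧ ∃ C δ : ℝ, 0 < δ ∧ LocStencil₂ Y C δ) :
    transport A m k Y = (-c) ^ k •
      transport (fun j Z => symB (push₄ (rowM (KStepUnit (d := d) Lc j) Lc) (colH (KStepUnit (d := d) Lc j) Lc) Z)) m k Y := by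
  have hBP : ∀ j (Z : BiTab d), ((∀ κ u κ' u', IsFF (Z κ u κ' u')) ∧ ∃ C δ : ℝ, 0 < δ ∧ LocStencil₂ Z C δ) →
      (∀ κ u κ' u', IsFF (symB (push₄ (rowM (KStepUnit (d := d) Lc j) Lc) (colH (KStepUnit (d := d) Lc j) Lc) Z) κ u κ' u')) ∧
        ∃ C δ : ℝ, 0 < δ ∧ LocStencil₂ (symB (push₄ (rowM (KStepUnit (d := d) Lc j) Lc) (colH (KStepUnit (d := d) Lc j) Lc) Z)) C δ :=
    fun j Z hZ => symPush_mem hK hmK j hZ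
  have hBP' : ∀ j (Z : BiTab d), ((∀ κ u κ' u', IsFF (Z κ u κ' u')) ∧ ∃ C δ : ℝ, 0 < δ ∧ LocStencil₂ Z C δ) →
      (∀ κ u κ' u', IsFF (((-c) • symB (push₄ (rowM (KStepUnit (d := d) Lc j) Lc) (colH (KStepUnit (d := d) Lc j) Lc) Z)) κ u κ' u')) ∧
        ∃ C δ : ℝ, 0 < δ ∧ LocStencil₂ ((-c) • symB (push₄ (rowM (KStepUnit (d := d) Lc j) Lc) (colH (KStepUnit (d := d) Lc j) Lc) Z)) C δ := by
    intro j Z hZ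
    obtain ⟨hff, C, δ, hδ, hl⟩ := hBP j Z hZ
    exact ⟨fun κ u κ' u' => isFF_smul (-c) (hff κ u κ' u'), |(-c)| * C, δ, hδ, locStencil₂_smul' (-c) hl⟩
  have hAB : ∀ j (Z : BiTab d), ((∀ κ u κ' u', IsFF (Z κ u κ' u')) ∧ ∃ C δ : ℝ, 0 < δ ∧ LocStencil₂ Z C δ) →
      A j Z = (-c) • symB (push₄ (rowM (KStepUnit (d := d) Lc j) Lc) (colH (KStepUnit (d := d) Lc j) Lc) Z) := by
    intro j Z hZ
    obtain ⟨hff, C, δ, hδ, hl⟩ := hZ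
    exact step_eq_symPush hK hmK hA j hff hl hδ
  have hsmul : ∀ j (r : ℝ) (Z : BiTab d), ((∀ κ u κ' u', IsFF (Z κ u κ' u')) ∧ ∃ C δ : ℝ, 0 < δ ∧ LocStencil₂ Z C δ) →
      symB (push₄ (rowM (KStepUnit (d := d) Lc j) Lc) (colH (KStepUnit (d := d) Lc j) Lc) (r • Z)) =
        r • symB (push₄ (rowM (KStepUnit (d := d) Lc j) Lc) (colH (KStepUnit (d := d) Lc j) Lc) Z) := by
    intro j r Z hZ
    obtain ⟨-, C, δ, hδ, hl⟩ := hZ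
    exact symPush_smul hK hmK j r hl hδ
  rw [transport_congr_mem hBP' hAB m hY k]
  exact transport_smul_eq (P := fun Z : BiTab d => (∀ κ u κ' u', IsFF (Z κ u κ' u')) ∧ ∃ C δ : ℝ, 0 < δ ∧ LocStencil₂ Z C δ)
    hBP hsmul (-c) m k hY

/-! ## §2 The leg chains of `K̃_·` are `±` the composite response families (leaf-12's dictionary, iterated) -/
/-- [folklore] **THE COLUMN CHAIN**: `legChain (j ↦ colH K̃_j Lc) m k = respStep (Lc^m) (Lc^(m+k+1))`. -/
theorem legChain_colH (m : ℕ) : ∀ k, legChain (fun j => colH (KStepUnit (d := d) Lc j) Lc) m k = respStep (d := d) (Lc ^ m) (Lc ^ (m + k + 1))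
  | 0 => by rw [legChain_zero, colH_KStepUnit]
  | k + 1 => by
    rw [legChain_succ, legChain_colH m k, show m + k + 1 = m + (k + 1) from rfl, legComp_respStep_colH m (k + 1)]

/-- [folklore] **THE ROW CHAIN**: `legChain (j ↦ rowM K̃_j Lc) m k = ± respStep (Lc^m) (Lc^(m+k+1))` (the sign alternates: `rowM = −respStep`,
`legComp_neg_left`). -/
theorem legChain_rowM (m : ℕ) : ∀ k,
    legChain (fun j => rowM (KStepUnit (d := d) Lc j) Lc) m k = respStep (d := d) (Lc ^ m) (Lc ^ (m + k + 1)) ∨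
      legChain (fun j => rowM (KStepUnit (d := d) Lc j) Lc) m k = -respStep (d := d) (Lc ^ m) (Lc ^ (m + k + 1))
  | 0 => Or.inr (by rw [legChain_zero, rowM_KStepUnit_eq])
  | k + 1 => by
    rcases legChain_rowM m k with h | h
    · right
      rw [legChain_succ, h, show m + k + 1 = m + (k + 1) from rfl, legComp_respStep_rowM m (k + 1)]
    · left
      rw [legChain_succ, h, legComp_neg_left, show m + k + 1 = m + (k + 1) from rfl, legComp_respStep_rowM m (k + 1), neg_neg]

/-- [folklore] Hence `|legChain (rowM K̃_· Lc) m k α x′ κ x| = |respStep (Lc^m) (Lc^(m+k+1)) α x′ κ x|`. -/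
theorem abs_legChain_rowM (m k : ℕ) (α : Fin (d + 1)) (x' : Fin (d + 1) → ℤ) (κ : Fin (d + 1)) (x : Fin (d + 1) → ℤ) :
    |legChain (fun j => rowM (KStepUnit (d := d) Lc j) Lc) m k α x' κ x| = |respStep (d := d) (Lc ^ m) (Lc ^ (m + k + 1)) α x' κ x| := by
  rcases legChain_rowM (d := d) (Lc := Lc) m k with h | h
  · rw [h]
  · rw [h, Pi.neg_apply, Pi.neg_apply, Pi.neg_apply, Pi.neg_apply, abs_neg]

end Step

/-! ## §3 ROW W3-F3a at `d = 3`: the transport is MARGINALLY BOUNDED under the pin -/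
section Three

variable {Lc : ℕ} [NeZero Lc] {CK mK : ℝ} {c : ℝ} {A : ℕ → BiTab 3 → BiTab 3}

/-- **ROW W3-F3a (T-marg) — THE `k`-FOLD TRANSPORT OF THE NORMALISED `T₂`-RECURSION IS MARGINALLY BOUNDED ON `LocStencil₂`, UNIFORMLY IN
`(m, k)`, UNDER THE PIN** (gan24-p1-g5's `SKELETON-W3.md` v1.0.2 §8.3 ∕ §8.6; NOT IN PRINT — our proof).  At `d = 3`, for every blocking
`Lc ≥ 1`, the K-slot's uniform decay `UnitDecayK 3 Lc (sfStep Lc) (smStep 3 Lc) CK mK` (`mK > 0`), a scalar with `|c| ≤ Lc^16` — for the scalar of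
record `c = cE₂·Lc^{2(d+1)}` this IS the pin `|cE₂| ≤ Lc^{2(d+1)}` — and the literal one-step maps `A j X = −(c • mmRead Lc (K̃_j ∘ ½(vertex2OfK K̃_j Lc X
κuκ′u′ + vertex2OfK K̃_j Lc X κ′u′κu) ∘ K̃_j))` (`= lin4 c K̃_j Lc X` by `T2RecursionAffine.lin4_apply`, `K̃_j = KStepUnit Lc j`): there are
`CT ≥ 0` and `0 < δT ≤ δin` with, FOR ALL `m k` and ALL tables, `LocStencil₂ X C δin → LocStencil₂ (transport A m k X) (CT·C) δT` — the text of
the hypothesis `hTmarg` of `WSlotT2OfPieces.t2Shape_of_rows` at `P m k := transport (lin4 c K̃_· Lc) m k`.  CHAIN: `k = 0` identity; first step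
general (`LinSandwichShape.locStencil₂_lin_step`, output ff-valued); the remaining `k − 1` steps are `(−c)^{k−1} •` ONE bond-symmetrised push through
the leg chains (`transport_eq_smul_symPush` ∘ leaf-17's `Push4Iter.transport_symPush`), whose legs are `±respStep (Lc^{m+1}) (Lc^{m+k})` (leaf-12's
`RespStepSemigroup` dictionary, `legChain_colH`∕`abs_legChain_rowM`) with leaf-12's envelopes `RespStepDecay.exists_respStep_decay_and_grad`
(`A·((Lc^{k−1})^5)⁻¹·e^{−κ₀‖quo …‖∞}`), bounded by the marginal four-leg mass count (F3-core-a) of record (leaf-03's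
`Push4LocalityRecord.exists_push₄_locStencil₂_const`), then `Push4Iter.locStencil₂_symB` and the scalar; the arithmetic
`|c|^{k−1}·((Lc^{k−1})^4·((Lc^{k−1})^5)⁻⁴) = (|c|·Lc^{−16})^{k−1} ≤ 1` (`geom_le_one`) is where the pin enters and NOTHING ELSE absorbs a power of
`c` (R12-3 ∕ R14-5).  `CT = 1 + |c|·cSand·(1 + K₄·C_resp⁴)`, `δT = κ₁/72`, `κ₁ = min κ₀ (min mK δin / 256)`. -/
theorem transport_marginal (hLc : 1 ≤ Lc) (hK : UnitDecayK 3 Lc (sfStep Lc) (smStep 3 Lc) CK mK) (hmK : 0 < mK)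
    (hA : ∀ j X κ u κ' u', A j X κ u κ' u' = -(c • mmRead Lc (comp (comp (KStepUnit (d := 3) Lc j)
      ((1 / 2 : ℝ) • (vertex2OfK (KStepUnit (d := 3) Lc j) Lc X κ u κ' u' + vertex2OfK (KStepUnit (d := 3) Lc j) Lc X κ' u' κ u)))
      (KStepUnit (d := 3) Lc j))))
    {δin : ℝ} (hδin : 0 < δin) :
    ∃ CT δT : ℝ, 0 ≤ CT ∧ 0 < δT ∧ δT ≤ δin ∧ (|c| ≤ (Lc : ℝ) ^ 16 → ∀ (m k : ℕ) (X : BiTab 3) (C : ℝ), 0 ≤ C → LocStencil₂ X C δin →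
      LocStencil₂ (transport A m k X) (CT * C) δT) := by
  have hK' : ∀ j, Decays (KStepUnit (d := 3) Lc j) CK mK := hK
  have hCK : 0 ≤ CK := (hK' 0).nonneg (Sum.inl 0)
  obtain ⟨κ₀, Cr, Cr', hκ₀, hCr, -, hN1, -⟩ := exists_respStep_decay_and_grad (Lc := Lc)
  have hm₀ : 0 < min mK δin := lt_min hmK hδin
  have hcS := cSand_nonneg (d := 3) hCK hm₀
  set cS : ℝ := (Fintype.card (Fib 3) : ℝ) * ((Fintype.card (Fib 3) : ℝ) * (CK * cBi 3 CK 1 (min mK δin)) *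
      Zl (3 + 1) (min mK δin / 32 / 2) * CK) * Zl (3 + 1) (min mK δin / 32 / 4) with hcS_def
  have hκ₁ : 0 < min κ₀ (min mK δin / 256) := lt_min hκ₀ (by positivity)
  have hκ₁δ : min κ₀ (min mK δin / 256) < min mK δin / 128 := by
    have := min_le_right κ₀ (min mK δin / 256); linarith
  have hκ₁κ₀ : min κ₀ (min mK δin / 256) ≤ κ₀ := min_le_left _ _
  obtain ⟨K₄, hK₄, hcore⟩ := exists_push₄_locStencil₂_const (d := 3) hκ₁ hκ₁δ
  refine ⟨1 + |c| * cS * (1 + K₄ * Cr ^ 4), min κ₀ (min mK δin / 256) / (6 * (3 + 1)) / 3, by positivity, by positivity, ?_,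
    fun hc m k X C hC hX => ?_⟩
  · have h2 : min mK δin ≤ δin := min_le_right _ _
    have h3 : min κ₀ (min mK δin / 256) / (6 * (3 + 1)) / 3 ≤ min κ₀ (min mK δin / 256) :=
      (div_le_self (by positivity) (by norm_num)).trans (div_le_self hκ₁.le (by norm_num))
    linarith [min_le_right κ₀ (min mK δin / 256)]
  have hCT1 : C ≤ (1 + |c| * cS * (1 + K₄ * Cr ^ 4)) * C := by nlinarith [mul_nonneg (mul_nonneg (abs_nonneg c) hcS) (by positivity : (0:ℝ) ≤ 1 + K₄ * Cr ^ 4)]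
  cases k with
  | zero =>
    rw [transport_zero]
    refine locStencil₂_weaken hX hCT1 ?_
    have h2 : min mK δin ≤ δin := min_le_right _ _
    have h3 : min κ₀ (min mK δin / 256) / (6 * (3 + 1)) / 3 ≤ min κ₀ (min mK δin / 256) :=
      (div_le_self (by positivity) (by norm_num)).trans (div_le_self hκ₁.le (by norm_num))
    linarith [min_le_right κ₀ (min mK δin / 256)]
  | succ k' =>
    rw [transport_succ']
    have hY := step_shape hLc hK' hmK hA m hX hδin
    have hYff := step_isFF hA m X
    have hδY : 0 < min mK δin / 128 := by positivity
    have hYC : |c| * (cS * C) ≤ (1 + |c| * cS * (1 + K₄ * Cr ^ 4)) * C := by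
      nlinarith [mul_nonneg (mul_nonneg (abs_nonneg c) hcS) (by positivity : (0:ℝ) ≤ K₄ * Cr ^ 4), mul_nonneg (abs_nonneg c) hcS]
    cases k' with
    | zero =>
      rw [transport_zero]
      refine locStencil₂_weaken hY hYC ?_
      have h3 : min κ₀ (min mK δin / 256) / (6 * (3 + 1)) / 3 ≤ min κ₀ (min mK δin / 256) :=
        (div_le_self (by positivity) (by norm_num)).trans (div_le_self hκ₁.le (by norm_num))
      linarith
    | succ k'' =>
      have hYmem : (∀ κ u κ' u', IsFF (A m X κ u κ' u')) ∧ ∃ C δ : ℝ, 0 < δ ∧ LocStencil₂ (A m X) C δ := ⟨hYff, _, _, hδY, hY⟩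
      have hlegs : ∀ j, ∃ C m : ℝ, 0 < m ∧ LegDecay (rowM (KStepUnit (d := 3) Lc j) Lc) Lc C m :=
        fun j => ⟨CK, mK, hmK, legDecay_rowM (hK' j)⟩
      have hlegs' : ∀ j, ∃ C m : ℝ, 0 < m ∧ LegDecay (colH (KStepUnit (d := 3) Lc j) Lc) Lc C m :=
        fun j => ⟨CK, mK, hmK, legDecay_colH (hK' j)⟩
      rw [transport_eq_smul_symPush hK' hmK hA (m + 1) (k'' + 1) hYmem,
        transport_symPush hLc hlegs hlegs' ⟨_, _, hδY, hY⟩ (m + 1) k'']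
      have hl_env : ∀ α x' κ x, |legChain (fun j => rowM (KStepUnit (d := 3) Lc j) Lc) (m + 1) k'' α x' κ x| ≤
          Cr * ((((Lc ^ (k'' + 1) : ℕ) : ℝ)) ^ (3 + 2))⁻¹ * Real.exp (-(min κ₀ (min mK δin / 256) * supNorm (quo (Lc ^ (k'' + 1)) x - x'))) := by
        intro α x' κ x
        rw [abs_legChain_rowM]
        refine (hN1 (m + 1) k'' α x' κ x).trans (mul_le_mul_of_nonneg_left (Real.exp_le_exp.2 ?_) (by positivity))
        nlinarith [supNorm_nonneg (quo (Lc ^ (k'' + 1)) x - x')]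
      have hr_env : ∀ μ y κ u, |legChain (fun j => colH (KStepUnit (d := 3) Lc j) Lc) (m + 1) k'' μ y κ u| ≤
          Cr * ((((Lc ^ (k'' + 1) : ℕ) : ℝ)) ^ (3 + 2))⁻¹ * Real.exp (-(min κ₀ (min mK δin / 256) * supNorm (quo (Lc ^ (k'' + 1)) u - y))) := by
        intro μ y κ u
        rw [legChain_colH]
        refine (hN1 (m + 1) k'' μ y κ u).trans (mul_le_mul_of_nonneg_left (Real.exp_le_exp.2 ?_) (by positivity))
        nlinarith [supNorm_nonneg (quo (Lc ^ (k'' + 1)) u - y)]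
      have hL1 : 1 ≤ Lc ^ (k'' + 1) := Nat.one_le_pow _ _ hLc
      have hpush := hcore (Lc ^ (k'' + 1)) hL1 _ _ Cr hl_env hr_env (A m X) _ hY
      have hsym := locStencil₂_symB hpush (by positivity)
      have hfin := locStencil₂_smul' ((-c) ^ (k'' + 1)) hsym
      refine locStencil₂_weaken hfin ?_ le_rfl
      -- the marginal arithmetic: the scalar of `k''+1` steps against the four-leg count at `L = Lc^(k''+1)`
      rw [abs_pow, abs_neg, Nat.cast_pow]
      have hg := geom_le_one hLc hc (k'' + 1)
      have hP : 0 ≤ K₄ * Cr ^ 4 * |c| * cS * C := by positivity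
      calc |c| ^ (k'' + 1) * (K₄ * Cr ^ 4 * (|c| * (cS * C)) *
            (((Lc : ℝ) ^ (k'' + 1)) ^ (3 + 1) * (((((Lc : ℝ) ^ (k'' + 1))) ^ (3 + 2))⁻¹) ^ 4))
          = (K₄ * Cr ^ 4 * |c| * cS * C) *
            (|c| ^ (k'' + 1) * (((Lc : ℝ) ^ (k'' + 1)) ^ (3 + 1) * (((((Lc : ℝ) ^ (k'' + 1))) ^ (3 + 2))⁻¹) ^ 4)) := by ring
        _ ≤ (K₄ * Cr ^ 4 * |c| * cS * C) * 1 := mul_le_mul_of_nonneg_left hg hP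
        _ ≤ (1 + |c| * cS * (1 + K₄ * Cr ^ 4)) * C := by nlinarith [mul_nonneg (abs_nonneg c) hcS]

/-- **ROW W3-F3a IN THE PIN's OWN CURRENCY** (`hTmarg` of `WSlotT2OfPieces.t2Shape_of_rows` at `d = 3`, constants first): for the scalar of
record `c = cE₂·Lc^{2(3+1)}` the constants `CT ≥ 0`, `0 < δT ≤ δin` are chosen BEFORE the pin, and UNDER `hpin : |cE₂| ≤ Lc^{2(3+1)}` the `k`-fold
transport of every `LocStencil₂ X C δin` is `LocStencil₂ (transport A m k X) (CT·C) δT` for all `m k`.  With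
`A := fun j ↦ T2RecursionAffine.lin4 (cE₂·Lc^{2(3+1)}) (unitK (sfStep Lc j) (smStep 3 Lc j) (KInvStep Lc j)) Lc` the hypothesis `hA` is `rfl`
(`lin4_apply`, `vsym`; `KStepUnit` is an `abbrev`) and the conclusion is the row text verbatim. -/
theorem transport_marginal_pin (hLc : 1 ≤ Lc) (hK : UnitDecayK 3 Lc (sfStep Lc) (smStep 3 Lc) CK mK) (hmK : 0 < mK) (cE₂ : ℝ)
    (hA : ∀ j X κ u κ' u', A j X κ u κ' u' = -((cE₂ * (Lc : ℝ) ^ (2 * (3 + 1))) • mmRead Lc (comp (comp (KStepUnit (d := 3) Lc j)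
      ((1 / 2 : ℝ) • (vertex2OfK (KStepUnit (d := 3) Lc j) Lc X κ u κ' u' + vertex2OfK (KStepUnit (d := 3) Lc j) Lc X κ' u' κ u)))
      (KStepUnit (d := 3) Lc j))))
    {δin : ℝ} (hδin : 0 < δin) :
    ∃ CT δT : ℝ, 0 ≤ CT ∧ 0 < δT ∧ δT ≤ δin ∧ (|cE₂| ≤ (Lc : ℝ) ^ (2 * (3 + 1)) →
      ∀ (m k : ℕ) (X : BiTab 3) (C : ℝ), 0 ≤ C → LocStencil₂ X C δin → LocStencil₂ (transport A m k X) (CT * C) δT) := by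
  obtain ⟨CT, δT, hCT, hδT, hδTin, h⟩ := transport_marginal (c := cE₂ * (Lc : ℝ) ^ (2 * (3 + 1))) hLc hK hmK hA hδin
  refine ⟨CT, δT, hCT, hδT, hδTin, fun hpin => h ?_⟩
  have hL : (0 : ℝ) ≤ (Lc : ℝ) ^ (2 * (3 + 1)) := by positivity
  rw [abs_mul, abs_of_nonneg hL]
  calc |cE₂| * (Lc : ℝ) ^ (2 * (3 + 1)) ≤ (Lc : ℝ) ^ (2 * (3 + 1)) * (Lc : ℝ) ^ (2 * (3 + 1)) :=
        mul_le_mul_of_nonneg_right hpin hL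
    _ = (Lc : ℝ) ^ 16 := by rw [← pow_add]

/-- **ROW W3-F3a, LITERAL TEXT** — the hypothesis `hTmarg` of `WSlotT2OfPieces.t2Shape_of_rows` at `d = 3` for the transport OF RECORD
`P m k := AffineUnroll.transport (fun j ↦ T2RecursionAffine.lin4 (cE₂·Lc^{2(3+1)}) (unitK (sfStep Lc j) (smStep 3 Lc j) (KInvStep Lc j)) Lc) m k`
(SKELETON-W3 v1.0.2 §8.3), constants first, the pin VERBATIM: `transport_marginal_pin` with `hA := rfl` (`lin4`, `vsym` unfold to the literal
one-step map).  Inputs: `1 ≤ Lc`, the K-slot `UnitDecayK 3 Lc (sfStep Lc) (smStep 3 Lc) CK mK` (`mK > 0`), `δin > 0`. -/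
theorem hTmarg_three (hLc : 1 ≤ Lc) (hK : UnitDecayK 3 Lc (sfStep Lc) (smStep 3 Lc) CK mK) (hmK : 0 < mK) (cE₂ : ℝ) {δin : ℝ}
    (hδin : 0 < δin) :
    ∃ CT δT : ℝ, 0 ≤ CT ∧ 0 < δT ∧ δT ≤ δin ∧ (|cE₂| ≤ (Lc : ℝ) ^ (2 * (3 + 1)) →
      ∀ (m k : ℕ) (X : BiTab 3) (C : ℝ), 0 ≤ C → LocStencil₂ X C δin →
        LocStencil₂ (transport (fun j => lin4 (cE₂ * (Lc : ℝ) ^ (2 * (3 + 1)))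
          (unitK (sfStep Lc j) (smStep 3 Lc j) (KInvStep (d := 3) Lc j)) Lc) m k X) (CT * C) δT) :=
  transport_marginal_pin (A := fun j => lin4 (cE₂ * (Lc : ℝ) ^ (2 * (3 + 1))) (unitK (sfStep Lc j) (smStep 3 Lc j) (KInvStep (d := 3) Lc j)) Lc)
    hLc hK hmK cE₂ (fun _ _ _ _ _ _ => rfl) hδin

end Three
end Summit.QuantumFields.BalabanUV.Beta.GAN24.TransportMarginal

end
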